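import Mathlib
import HarnessLib
import Summits.NavierStokesRegularity.NavierStokesRegularity.Theorems.TaylorModelRungThreeSoundnessVectorField

/-!
# Line `taylor-model` on crux K1b-DR (`ExactWindowRungThree.DerivativeEnclosureCertificateR`,
# stmt-NavierStokesRegularity-23954) — VECTOR STEP LEMMA, part 2: jets along a solution and the
# COMPONENTWISE Lagrange remainder

Second half of §1 of `pub/pub-ns-dss/certificates/S1-VECTOR-23954.md` (director dss_56 (i)).  Setting of part 1
(`…SoundnessVectorField`): finite index type `ι`, bundled bilinear field `Q`, and ABSTRACT Taylor jet maps
`T : (ι → ℝ) → ℕ → ι → ℝ` obeying the Cauchy-product recursion of `u' = Q(u,u)` (`T x 0 = x`,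
`(k+1)·T x (k+1) = Σ_{i≤k} Q (T x i) (T x (k-i))`, the literal hypotheses of S1 / `IsMajorantSystem.T_zero/T_succ`).

* `hasDerivWithinAt_Q_comp` — Leibniz rule for `σ ↦ Q (f σ) (g σ) c` along two differentiable curves;
* `jet_reindex` — the re-indexing identity
  `Σ_{i≤k} [(i+1)·Q(T_{i+1},T_{k-i}) + (k-i+1)·Q(T_i,T_{k-i+1})] = (k+1)(k+2)·T_{k+2}` (recursion only);
* `hasDerivWithinAt_jet` — along ANY solution `ψ` (on any set `S`): `d/dσ T (ψ σ) k c = (k+1)·T (ψ σ) (k+1) c`,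
  i.e. the jets are the normalised time derivatives, proved from the recursion alone (no analyticity);
* `abs_sub_taylor_le` — **componentwise Lagrange remainder**: if `|T (ψ s) (p+1) c| ≤ J` along `[0,h]` then
  `|ψ s c − Σ_{k≤p} T (ψ 0) k c · s^k| ≤ J · s^(p+1)` on `[0,h]` (factorial remainder ladder `F_{m+1}' = F_m`
  closed by `image_norm_le_of_norm_deriv_right_le_deriv_boundary`; no `iteratedDeriv`, no `taylorWithinEval`);
* `abs_sub_taylor_le_of_mem_Icc` — the box form: confinement in `[lo,hi]` + a jet enclosure `J c` of order `p+1`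
  over the box (what an interval evaluation of the recursion certifies) give the remainder for every coordinate.

MODEL-lattice bookkeeping only (rung TL-M3 of the NS ladder: one finite-dimensional model ODE); nothing
here is a statement about the Navier–Stokes equations.
-/

noncomputable section

-- the sub-problem namespace repeats the summit name by design (D-0017)
set_option linter.dupNamespace false

namespace Summit.NavierStokesRegularity.NavierStokesRegularity.Theorems.TaylorModelVector

open scoped BigOperators Topology
open Set Filter

variable {ι : Type*} [Fintype ι] [DecidableEq ι]
  (Q : (ι → ℝ) →ₗ[ℝ] (ι → ℝ) →ₗ[ℝ] ι → ℝ) {T : (ι → ℝ) → ℕ → ι → ℝ}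

/-! ### Leibniz rule for the bilinear field along curves -/

/-- `d/dσ Q (f σ) (g σ) c = Q f' (g s) c + Q (f s) g' c` (within any set). [folklore] -/
theorem hasDerivWithinAt_Q_comp {f g : ℝ → ι → ℝ} {f' g' : ι → ℝ} {S : Set ℝ} {s : ℝ}
    (hf : HasDerivWithinAt f f' S s) (hg : HasDerivWithinAt g g' S s) (c : ι) :
    HasDerivWithinAt (fun σ => Q (f σ) (g σ) c) (Q f' (g s) c + Q (f s) g' c) S s := by
  have hf' := hasDerivWithinAt_pi.1 hf
  have hg' := hasDerivWithinAt_pi.1 hg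
  have e1 : (fun σ => Q (f σ) (g σ) c) =
      fun σ => ∑ a, ∑ a', f σ a * g σ a' * Q (Pi.single a 1) (Pi.single a' 1) c :=
    funext fun σ => Q_expand Q _ _ _
  have e2 : Q f' (g s) c + Q (f s) g' c =
      ∑ a, ∑ a', (f' a * g s a' + f s a * g' a') * Q (Pi.single a 1) (Pi.single a' 1) c := by
    rw [Q_expand Q f' (g s) c, Q_expand Q (f s) g' c, ← Finset.sum_add_distrib]
    refine Finset.sum_congr rfl fun a _ => ?_
    rw [← Finset.sum_add_distrib]
    exact Finset.sum_congr rfl fun a' _ => by ring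
  rw [e1, e2]
  refine HasDerivWithinAt.fun_sum fun a _ => HasDerivWithinAt.fun_sum fun a' _ => ?_
  exact ((hf' a).mul (hg' a')).mul_const _

/-! ### The re-indexing identity of the Cauchy-product recursion -/

omit [Fintype ι] [DecidableEq ι] in
/-- `Σ_{i≤k} [(i+1)·Q(T_{i+1},T_{k-i})_c + (k-i+1)·Q(T_i,T_{k-i+1})_c] = (k+1)·((k+2)·T_{k+2,c})` — a consequence
of the recursion at level `k+1` alone (each ordered pair of total degree `k+1` is counted `k+1` times). [folklore] -/
theorem jet_reindex
    (hTs : ∀ x (k : ℕ) c, ((k : ℝ) + 1) * T x (k + 1) c =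
      ∑ i ∈ Finset.range (k + 1), Q (T x i) (T x (k - i)) c)
    (y : ι → ℝ) (k : ℕ) (c : ι) :
    ∑ i ∈ Finset.range (k + 1), (((i : ℝ) + 1) * Q (T y (i + 1)) (T y (k - i)) c
      + (((k - i : ℕ) : ℝ) + 1) * Q (T y i) (T y (k - i + 1)) c)
    = ((k : ℝ) + 1) * ((((k + 1 : ℕ) : ℝ) + 1) * T y (k + 1 + 1) c) := by
  set A : ℕ → ℝ := fun j => Q (T y j) (T y (k + 1 - j)) c with hA
  have hrec : (((k + 1 : ℕ) : ℝ) + 1) * T y (k + 1 + 1) c = ∑ j ∈ Finset.range (k + 1 + 1), A j :=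
    hTs y (k + 1) c
  have h1 : ∀ i ∈ Finset.range (k + 1),
      ((i : ℝ) + 1) * Q (T y (i + 1)) (T y (k - i)) c = (((i + 1 : ℕ)) : ℝ) * A (i + 1) := by
    intro i _
    simp only [hA, Nat.add_sub_add_right, Nat.cast_succ]
  have h2 : ∀ i ∈ Finset.range (k + 1),
      (((k - i : ℕ) : ℝ) + 1) * Q (T y i) (T y (k - i + 1)) c = ((k : ℝ) + 1 - i) * A i := by
    intro i hi
    have hik : i ≤ k := Nat.lt_succ_iff.mp (Finset.mem_range.mp hi)
    have e1 : k - i + 1 = k + 1 - i := by omega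
    simp only [hA]
    rw [e1, Nat.cast_sub hik]
    ring
  rw [Finset.sum_add_distrib, Finset.sum_congr rfl h1, Finset.sum_congr rfl h2]
  have h3 : ∑ i ∈ Finset.range (k + 1), (((i + 1 : ℕ)) : ℝ) * A (i + 1) =
      ∑ j ∈ Finset.range (k + 1 + 1), (j : ℝ) * A j := by
    rw [Finset.sum_range_succ' (fun j => (j : ℝ) * A j)]
    simp
  have h4 : ∑ i ∈ Finset.range (k + 1), ((k : ℝ) + 1 - i) * A i =
      ∑ j ∈ Finset.range (k + 1 + 1), ((k : ℝ) + 1 - j) * A j := by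
    rw [Finset.sum_range_succ (fun j => ((k : ℝ) + 1 - j) * A j) (k + 1)]
    push_cast
    ring
  rw [h3, h4, ← Finset.sum_add_distrib, hrec, Finset.mul_sum]
  exact Finset.sum_congr rfl fun j _ => by ring

/-! ### Jets along a solution are the normalised time derivatives -/

/-- **`d/dσ T (ψ σ) k c = (k+1)·T (ψ σ) (k+1) c`** along any solution `ψ` of `ψ' = Q(ψ,ψ)` (derivatives within a
set `S`, at every point of `S`), from the recursion alone. [folklore] -/
theorem hasDerivWithinAt_jet (hT0 : ∀ x, T x 0 = x)
    (hTs : ∀ x (k : ℕ) c, ((k : ℝ) + 1) * T x (k + 1) c =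
      ∑ i ∈ Finset.range (k + 1), Q (T x i) (T x (k - i)) c)
    {ψ : ℝ → ι → ℝ} {S : Set ℝ} (hψ : ∀ s ∈ S, HasDerivWithinAt ψ (Q (ψ s) (ψ s)) S s) :
    ∀ (k : ℕ), ∀ s ∈ S, ∀ c, HasDerivWithinAt (fun σ => T (ψ σ) k c) (((k : ℝ) + 1) * T (ψ s) (k + 1) c) S s := by
  intro k
  induction k using Nat.strong_induction_on with
  | _ k IH =>
    intro s hs c
    rcases k with _ | k
    · have e : (((0 : ℕ) : ℝ) + 1) * T (ψ s) (0 + 1) c = Q (ψ s) (ψ s) c := by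
        rw [hTs]
        simp [hT0]
      rw [e]
      have ef : (fun σ => T (ψ σ) 0 c) = fun σ => ψ σ c := funext fun σ => by rw [hT0]
      rw [ef]
      exact (hasDerivWithinAt_pi.1 (hψ s hs)) c
    · have IH' : ∀ i ≤ k, HasDerivWithinAt (fun σ => T (ψ σ) i) (((i : ℝ) + 1) • T (ψ s) (i + 1)) S s :=
        fun i hi => hasDerivWithinAt_pi.2 fun a => by
          simpa only [Pi.smul_apply, smul_eq_mul] using IH i (Nat.lt_succ_of_le hi) s hs a
      have hk0 : ((k : ℝ) + 1) ≠ 0 := by positivity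
      have hfun : (fun σ => T (ψ σ) (k + 1) c) =
          fun σ => ((k : ℝ) + 1)⁻¹ * ∑ i ∈ Finset.range (k + 1), Q (T (ψ σ) i) (T (ψ σ) (k - i)) c := by
        funext σ
        rw [← hTs, ← mul_assoc, inv_mul_cancel₀ hk0, one_mul]
      have hsum : HasDerivWithinAt
          (fun σ => ∑ i ∈ Finset.range (k + 1), Q (T (ψ σ) i) (T (ψ σ) (k - i)) c)
          (∑ i ∈ Finset.range (k + 1), (((i : ℝ) + 1) * Q (T (ψ s) (i + 1)) (T (ψ s) (k - i)) c
            + (((k - i : ℕ) : ℝ) + 1) * Q (T (ψ s) i) (T (ψ s) (k - i + 1)) c)) S s := by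
        refine HasDerivWithinAt.fun_sum fun i hi => ?_
        have hik : i ≤ k := Nat.lt_succ_iff.mp (Finset.mem_range.mp hi)
        have h1 := hasDerivWithinAt_Q_comp Q (IH' i hik) (IH' (k - i) (Nat.sub_le k i)) c
        refine h1.congr_deriv ?_
        rw [map_smul, LinearMap.smul_apply, Pi.smul_apply, smul_eq_mul, map_smul, Pi.smul_apply,
          smul_eq_mul]
      rw [hfun]
      have hfin := hsum.const_mul (((k : ℝ) + 1)⁻¹)
      rw [jet_reindex Q hTs (ψ s) k c, ← mul_assoc, inv_mul_cancel₀ hk0, one_mul] at hfin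
      exact hfin

/-! ### The componentwise Lagrange remainder -/

/-- **COMPONENTWISE LAGRANGE REMAINDER** along a solution on `[0,h]`: a bound `|T (ψ s) (p+1) c| ≤ J` of ONE
coordinate of the order-`p+1` jet along the trajectory gives `|ψ s c − Σ_{k≤p} T (ψ 0) k c s^k| ≤ J s^(p+1)` for
`s ∈ [0,h]` (Taylor–Lagrange in one real variable per coordinate; here by the remainder ladder
`F_m := D_{p+1-m} − Σ_{i<m} D_{p+1-m+i}(0) s^i/i!`, `D_j := j!·T(ψ ·) j c`, `F_{m+1}' = F_m`, `|F_m| ≤ (p+1)! J s^m/m!`).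
[folklore] -/
theorem abs_sub_taylor_le (hT0 : ∀ x, T x 0 = x)
    (hTs : ∀ x (k : ℕ) c, ((k : ℝ) + 1) * T x (k + 1) c =
      ∑ i ∈ Finset.range (k + 1), Q (T x i) (T x (k - i)) c)
    {ψ : ℝ → ι → ℝ} {h : ℝ} (hψ : ∀ s ∈ Icc 0 h, HasDerivWithinAt ψ (Q (ψ s) (ψ s)) (Icc 0 h) s)
    {p : ℕ} {c : ι} {J : ℝ} (hJ : ∀ s ∈ Icc 0 h, |T (ψ s) (p + 1) c| ≤ J) :
    ∀ s ∈ Icc 0 h, |ψ s c - ∑ k ∈ Finset.range (p + 1), T (ψ 0) k c * s ^ k| ≤ J * s ^ (p + 1) := by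
  intro s hs
  -- factorial-normalised derivatives along the curve and the remainder ladder
  obtain ⟨D, hD⟩ : ∃ D : ℕ → ℝ → ℝ, D = fun j σ => (j.factorial : ℝ) * T (ψ σ) j c := ⟨_, rfl⟩
  have hDder : ∀ j, ∀ σ ∈ Icc 0 h, HasDerivWithinAt (D j) (D (j + 1) σ) (Icc 0 h) σ := by
    intro j σ hσ
    have h1 := (hasDerivWithinAt_jet Q hT0 hTs hψ j σ hσ c).const_mul (j.factorial : ℝ)
    rw [hD]
    refine h1.congr_deriv ?_
    simp only [Nat.factorial_succ, Nat.cast_mul, Nat.cast_succ]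
    ring
  obtain ⟨F, hF⟩ : ∃ F : ℕ → ℝ → ℝ, F = fun m σ =>
      D (p + 1 - m) σ - ∑ i ∈ Finset.range m, D (p + 1 - m + i) 0 * σ ^ i / (i.factorial : ℝ) :=
    ⟨_, rfl⟩
  have hJ0 : 0 ≤ J := (abs_nonneg _).trans (hJ 0 ⟨le_rfl, hs.1.trans hs.2⟩)
  have claim : ∀ m, m ≤ p + 1 → ∀ σ ∈ Icc 0 h,
      |F m σ| ≤ ((p + 1).factorial : ℝ) * J * σ ^ m / (m.factorial : ℝ) := by
    intro m
    induction m with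
    | zero =>
      intro _ σ hσ
      rw [hF, hD]
      simp only [Nat.sub_zero, Finset.range_zero, Finset.sum_empty, sub_zero, pow_zero, mul_one,
        Nat.factorial_zero, Nat.cast_one, div_one]
      rw [abs_mul, abs_of_nonneg (Nat.cast_nonneg _)]
      exact mul_le_mul_of_nonneg_left (hJ σ hσ) (Nat.cast_nonneg _)
    | succ m IHm =>
      intro hm σ hσ
      have IH := IHm (Nat.le_of_succ_le hm)
      have hmp : m ≤ p := Nat.le_of_lt_succ hm
      have epm : p + 1 - (m + 1) = p - m := by omega
      have epm' : p + 1 - m = p - m + 1 := by omega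
      -- the derivative of `F (m+1)` is `F m`
      have hderF : ∀ x ∈ Icc 0 h, HasDerivWithinAt (F (m + 1)) (F m x) (Icc 0 h) x := by
        intro x hx
        have hpoly : HasDerivWithinAt
            (fun σ => ∑ i ∈ Finset.range (m + 1), D (p - m + i) 0 * σ ^ i / (i.factorial : ℝ))
            (∑ i ∈ Finset.range (m + 1), D (p - m + i) 0 * ((i : ℝ) * x ^ (i - 1)) / (i.factorial : ℝ))
            (Icc 0 h) x := by
          refine HasDerivWithinAt.fun_sum fun i _ => ?_
          exact ((hasDerivWithinAt_pow i x).const_mul _).div_const _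
        have hmain := (hDder (p - m) x hx).sub hpoly
        have eF : F (m + 1) = fun σ =>
            D (p - m) σ - ∑ i ∈ Finset.range (m + 1), D (p - m + i) 0 * σ ^ i / (i.factorial : ℝ) := by
          funext σ
          simp only [hF, epm]
        -- value: `F m x = D (p-m+1) x - Σ_{i<m+1} D (p-m+i) 0 · (i x^(i-1)) / i!`
        have hval : D (p - m + 1) x - ∑ i ∈ Finset.range (m + 1),
              D (p - m + i) 0 * ((i : ℝ) * x ^ (i - 1)) / (i.factorial : ℝ) = F m x := by
          simp only [hF, epm']
          congr 1
          rw [Finset.sum_range_succ']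
          simp only [Nat.cast_zero, zero_mul, mul_zero, zero_div, add_zero]
          refine Finset.sum_congr rfl fun i _ => ?_
          have hi1 : ((i + 1 : ℕ) : ℝ) ≠ 0 := by positivity
          have hif : ((i.factorial : ℕ) : ℝ) ≠ 0 := by positivity
          rw [Nat.add_sub_cancel, Nat.factorial_succ i, Nat.cast_mul,
            show p - m + (i + 1) = p - m + 1 + i by omega]
          field_simp
        rw [eF]
        exact hmain.congr_deriv hval
      have hcont : ContinuousOn (F (m + 1)) (Icc 0 h) := fun x hx => (hderF x hx).continuousWithinAt
      have hderF' : ∀ x ∈ Ico 0 h, HasDerivWithinAt (F (m + 1)) (F m x) (Ici x) x := fun x hx =>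
        (hderF x (Ico_subset_Icc_self hx)).mono_of_mem_nhdsWithin
          (mem_of_superset (Icc_mem_nhdsGE hx.2) (Icc_subset_Icc_left hx.1))
      have hF0 : ‖F (m + 1) 0‖ ≤ ((p + 1).factorial : ℝ) * J * (0:ℝ) ^ (m + 1) / ((m + 1).factorial : ℝ) := by
        have e0 : F (m + 1) 0 = 0 := by
          simp only [hF, epm]
          rw [Finset.sum_range_succ']
          simp
        rw [e0, norm_zero, zero_pow (Nat.succ_ne_zero m), mul_zero, zero_div]
      have hB : ∀ x, HasDerivAt (fun σ => ((p + 1).factorial : ℝ) * J * σ ^ (m + 1) / ((m + 1).factorial : ℝ))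
          (((p + 1).factorial : ℝ) * J * x ^ m / (m.factorial : ℝ)) x := by
        intro x
        have h1 := (((hasDerivAt_pow (m + 1) x).const_mul (((p + 1).factorial : ℝ) * J))).div_const
          ((m + 1).factorial : ℝ)
        refine h1.congr_deriv ?_
        have hm1 : ((m + 1 : ℕ) : ℝ) ≠ 0 := by positivity
        have hmf : ((m.factorial : ℕ) : ℝ) ≠ 0 := by positivity
        rw [Nat.add_sub_cancel, Nat.factorial_succ m, Nat.cast_mul]
        field_simp
      have hbound : ∀ x ∈ Ico 0 h, ‖F m x‖ ≤ ((p + 1).factorial : ℝ) * J * x ^ m / (m.factorial : ℝ) :=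
        fun x hx => by rw [Real.norm_eq_abs]; exact IH x (Ico_subset_Icc_self hx)
      have key := image_norm_le_of_norm_deriv_right_le_deriv_boundary hcont hderF' hF0 hB hbound hσ
      rwa [Real.norm_eq_abs] at key
  -- `m = p + 1`
  have fin := claim (p + 1) le_rfl s hs
  have hfac : ((p + 1).factorial : ℝ) ≠ 0 := by positivity
  have eval : F (p + 1) s = ψ s c - ∑ k ∈ Finset.range (p + 1), T (ψ 0) k c * s ^ k := by
    rw [hF, hD]
    simp only [Nat.sub_self, zero_add, Nat.factorial_zero, Nat.cast_one, one_mul, hT0]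
    congr 1
    refine Finset.sum_congr rfl fun k _ => ?_
    have hk : (k.factorial : ℝ) ≠ 0 := by positivity
    field_simp
  rw [eval] at fin
  calc |ψ s c - ∑ k ∈ Finset.range (p + 1), T (ψ 0) k c * s ^ k|
      ≤ ((p + 1).factorial : ℝ) * J * s ^ (p + 1) / ((p + 1).factorial : ℝ) := fin
    _ = J * s ^ (p + 1) := by field_simp

/-- **Box form** (the shape of memo §1): a solution confined to `[lo,hi]` on `[0,h]` and an order-`p+1` jet
enclosure `|T y (p+1) c| ≤ J c` over the box give `|ψ s c − Σ_{k≤p} T (ψ 0) k c s^k| ≤ J c · s^(p+1)` for every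
coordinate. [folklore] -/
theorem abs_sub_taylor_le_of_mem_Icc (hT0 : ∀ x, T x 0 = x)
    (hTs : ∀ x (k : ℕ) c, ((k : ℝ) + 1) * T x (k + 1) c =
      ∑ i ∈ Finset.range (k + 1), Q (T x i) (T x (k - i)) c)
    {ψ : ℝ → ι → ℝ} {h : ℝ} (hψ : ∀ s ∈ Icc 0 h, HasDerivWithinAt ψ (Q (ψ s) (ψ s)) (Icc 0 h) s)
    {lo hi : ι → ℝ} (hbox : ∀ s ∈ Icc 0 h, ψ s ∈ Icc lo hi) {p : ℕ} {J : ι → ℝ}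
    (hJ : ∀ y ∈ Icc lo hi, ∀ c, |T y (p + 1) c| ≤ J c) :
    ∀ s ∈ Icc 0 h, ∀ c, |ψ s c - ∑ k ∈ Finset.range (p + 1), T (ψ 0) k c * s ^ k| ≤ J c * s ^ (p + 1) :=
  fun s hs c => abs_sub_taylor_le Q hT0 hTs hψ (fun σ hσ => hJ _ (hbox σ hσ) c) s hs

end Summit.NavierStokesRegularity.NavierStokesRegularity.Theorems.TaylorModelVector

end
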